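import Summits.Ventures.CertifiedManyBodySolver.Theorems.TcThermcert1HighTempClusterSum
import Summits.Ventures.CertifiedManyBodySolver.Theorems.TcThermcert1FreeGasCurrentCovariance
import Summits.Ventures.CertifiedManyBodySolver.Theorems.TcThermcert1QbpSeamFamily
import Summits.Ventures.CertifiedManyBodySolver.Theorems.TcThermcert1FugacityProjection
import Summits.HubbardSuperconductivity.HubbardLadder.Bounds.ThermalStiffnessCeilingTPrime
import Literature.MathematicalPhysics.QuantumLattice.LatticeToriProofs
import HarnessLib

/-!
# High-temperature current clustering for TcThermcert1's Hypothesis C — part 5: the torus and the small-`β` rung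

Helper file for route `TcThermcert1` (crux K1′ `ThermalStiffnessCeilingU8b8_le_7o44`, item `stmt-Ventures-24560`; line
`Cruxes/ThermalStiffnessCeilingU8b8_le_7o44/Lines/gauge_qbp_far_seam.lean` v1.5, registered helper stub `stub_currentClustering8_smallBeta`,
director-hubbard (α′) tc INBOX I2363). Parts 1–4 (`TcThermcert1HighTemp{TimeReversal, PolymerCombinatorics, RootedAnimals, Expansion, TermBounds,
ClusterSum}.lean`) give, on any finite graph of maximal degree `Δ`, the canonical-ensemble high-temperature bound
`|tr(P_{M,N} e^{−βH} A j_{ab})| ≤ C(β) (λ(β)/λ₁)^d ‖A‖ tr(P_{M,N} e^{−βH})` and `tr(P_{M,N} e^{−βH} j_{ab}) = 0`. Here: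

* §1 the same bound in the language of the compressed Gibbs state `gibbsState β H_p`, i.e. the covariance form
  `‖ω_p(A j) − ω_p(A) ω_p(j)‖ ≤ C(β) (λ(β)/λ₁)^d ‖A‖` (dictionary `gibbsState_toBlock_eq_sectorTrace`);
* §2 the flux-free `t–U` torus `hubbardTorusTT'Flux L 0 U 0 = Σ_Z hubbardTermOp (fermionTorusGraph 2 L) 1 U 0 Z` (`Δ = 4`, torus sup-distance);
* §3 the choice of parameters: `λ₁ = 1/722²`, `β₀ = λ₁ e^{−20(2+|U|)}/2`, `ξ(β) = 1/log(λ₁/λ(β))`;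
* §4 **THE SMALL-`β` RUNG OF HYPOTHESIS C FOR EVERY `U` AND EVERY FILLING**: `∀ U n, ∃ β₀ > 0, ∀ β ∈ (0, β₀], ∃ ξ > 0, ∃ C k L₀, …` — the
  line's `∃ ξ, CurrentClustering U n β ξ` with `CurrentClustering`, `sectorExpect`, `bondCurrent`, `SectorPreserving`, `sectorPred` unfolded
  (`highTemp_currentClusteringBody`; `k = 0`, `L₀ = 0`; the sector-preservation premise on `A` is not used), its instance at the anchor
  `(U, n) = (8, 7/8)` in the registered stub's shape (`currentClustering8_smallBeta_body`), and the `U = 10` twin (`currentClustering10_smallBeta_body`).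

Mechanism: polymer (Möbius) expansion of `e^{−βH}` in the local terms around the bond + TIME REVERSAL (every polymer configuration whose
bond-attached cluster misses `supp A` has trace exactly zero), iterated-difference Cauchy smallness, rooted lattice-animal counting — no
fugacities, no saddle point, no non-degeneracy condition. [cite: Ueltschi1999, §2.3 and §3]; [cite: FriedliVelenik2017, §5.2].
HONEST FRAMING: a HELPER RUNG inside the trivially-known high-temperature regime (`β₀·t ≈ 10⁻⁶ e^{−20(2+|U|)}`); it decides NOTHING about
the bet C8 at `β·t = 8`; K1′/K1 remain CONDITIONAL ceilings; this is not a `T_c` estimate and superconductivity in the Hubbard model is NOT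
proved by anything here. No definitions; no `sorry`.
-/

noncomputable section

namespace Summit.Ventures.CertifiedManyBodySolver.Theorems.TcThermcert1.HighTempCurrentClustering

open Matrix Finset
open Literature.MathematicalPhysics.QuantumLattice
open Literature.Probability.LatticeModels (TorusSite torusGraph)
open Summit.Ventures.CertifiedManyBodySolver.Theorems.TcThermcert1.GaugeQbpFarSeam
open Summit.Ventures.CertifiedManyBodySolver.Theorems.TcThermcert1.FreeGasCurrentClustering
open Summit.Ventures.CertifiedManyBodySolver.Theorems.TcThermcert1.ZeroFreeCorridor (card_and_two_mul_card_filter_iff)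
open scoped Matrix.Norms.L2Operator ComplexOrder

/-! ## §1 The covariance form on a general graph -/

section Graph

variable {Λ : Type*} [LinearOrder Λ] [Fintype Λ] (G : SimpleGraph Λ) [DecidableRel G.Adj] (t U μ : ℝ)

/-- **Graph-level canonical-sector current covariance bound (high temperature).** With the hypotheses of
`norm_trace_proj_gibbsWeight_mul_current_le` and the `(M,N)` sector presented by `p`:
`‖ω_p(A j_{ab}) − ω_p(A) ω_p(j_{ab})‖ ≤ 16 e^{2β(2Δ+1)E} (1 + (2Δ+1)·2√λ₁)² (λ(β)/λ₁)^d ‖A‖`. [cite: Ueltschi1999, §3] -/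
theorem norm_sectorCov_current_le_graph {Δ : ℕ} (hΔ : ∀ x : Λ, (Finset.univ.filter fun y => G.Adj x y).card ≤ Δ)
    (D : Λ → Λ → ℕ) (hD0 : ∀ x, D x x = 0) (htri : ∀ x y z, D x z ≤ D x y + D y z) (hadj : ∀ x y, G.Adj x y → D x y ≤ 1)
    {β : ℝ} (hβ : 0 ≤ β) {lam₁ : ℝ} (hlam₁ : lam₁ ≤ 1)
    (hsmall : ((2 * (2 * Δ + 1) : ℕ) + 1 : ℝ) ^ 2 * Real.sqrt lam₁ ≤ 1 / 2)
    (hβl : β * Real.exp ((β + 1) * (2 * |t| + |U| + 2 * |μ|)) * Real.exp (2 * β * (2 * Δ + 1 : ℕ) * (2 * |t| + |U| + 2 * |μ|)) ≤ lam₁)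
    {M N : ℕ} (p : Finset (Orb Λ) → Prop) [DecidablePred p] (hp : ∀ s, p s ↔ (upPart s).card = M ∧ (downPart s).card = N)
    {X : Finset Λ} {A : Matrix (Finset (Orb Λ)) (Finset (Orb Λ)) ℂ} (hA : A ∈ carEvenSubalgebra (orbSet X))
    (a b : Λ) {d : ℕ} (hd : ∀ x ∈ X, d ≤ D a x ∧ d ≤ D b x) :
    ‖gibbsState β ((∑ Z, hubbardTermOp G t U μ Z).toBlock p p)
          ((A * ∑ σ : Fin 2, ((-Complex.I) • (creation (orb a σ) * annihilation (orb b σ)) +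
            Complex.I • (creation (orb b σ) * annihilation (orb a σ)))).toBlock p p) -
        gibbsState β ((∑ Z, hubbardTermOp G t U μ Z).toBlock p p) (A.toBlock p p) *
          gibbsState β ((∑ Z, hubbardTermOp G t U μ Z).toBlock p p)
            ((∑ σ : Fin 2, ((-Complex.I) • (creation (orb a σ) * annihilation (orb b σ)) +
              Complex.I • (creation (orb b σ) * annihilation (orb a σ)))).toBlock p p)‖ ≤
      16 * Real.exp (2 * β * (2 * Δ + 1 : ℕ) * (2 * |t| + |U| + 2 * |μ|)) * (1 + (2 * Δ + 1 : ℕ) * (2 * Real.sqrt lam₁)) ^ 2 *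
        (β * Real.exp ((β + 1) * (2 * |t| + |U| + 2 * |μ|)) * Real.exp (2 * β * (2 * Δ + 1 : ℕ) * (2 * |t| + |U| + 2 * |μ|)) / lam₁) ^ d *
        ‖A‖ := by
  have hHP : PreservesSectors (∑ Z, hubbardTermOp G t U μ Z) := preservesSectors_sum_hubbardTermOp G t U μ Finset.univ
  have hH : (∑ Z, hubbardTermOp G t U μ Z).IsHermitian := isHermitian_sum_hubbardTermOp G t U μ Finset.univ
  rw [gibbsState_toBlock_eq_sectorTrace hHP β p hp, gibbsState_toBlock_eq_sectorTrace hHP β p hp,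
    gibbsState_toBlock_eq_sectorTrace hHP β p hp, trace_proj_gibbsWeight_current_eq_zero G t U μ β a b M N, mul_zero, mul_zero,
    sub_zero, norm_mul, norm_inv]
  have hmain := norm_trace_proj_gibbsWeight_mul_current_le G t U μ hΔ D hD0 htri hadj hβ M N hlam₁ hsmall hβl hA a b hd
  set Z₀ : ℝ := ((spinSectorProj M N * gibbsWeight β (∑ Z, hubbardTermOp G t U μ Z)).trace).re with hZ₀
  have hZ₀0 : 0 ≤ Z₀ := (Complex.nonneg_iff.1 (posSemidef_spinSectorProj_mul_gibbsWeight hH hHP β M N).trace_nonneg).1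
  have hZc : (spinSectorProj M N * gibbsWeight β (∑ Z, hubbardTermOp G t U μ Z)).trace = (Z₀ : ℂ) :=
    trace_spinSectorProj_mul_gibbsWeight_eq_re hH hHP β M N
  rw [hZc, Complex.norm_real, Real.norm_of_nonneg hZ₀0]
  have hC : 0 ≤ 16 * Real.exp (2 * β * (2 * Δ + 1 : ℕ) * (2 * |t| + |U| + 2 * |μ|)) * (1 + (2 * Δ + 1 : ℕ) * (2 * Real.sqrt lam₁)) ^ 2 *
      (β * Real.exp ((β + 1) * (2 * |t| + |U| + 2 * |μ|)) * Real.exp (2 * β * (2 * Δ + 1 : ℕ) * (2 * |t| + |U| + 2 * |μ|)) / lam₁) ^ d *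
      ‖A‖ := by
    have hq : 0 ≤ β * Real.exp ((β + 1) * (2 * |t| + |U| + 2 * |μ|)) *
        Real.exp (2 * β * (2 * Δ + 1 : ℕ) * (2 * |t| + |U| + 2 * |μ|)) / lam₁ := by
      rcases le_or_gt 0 lam₁ with h | h
      · positivity
      · have : β * Real.exp ((β + 1) * (2 * |t| + |U| + 2 * |μ|)) *
            Real.exp (2 * β * (2 * Δ + 1 : ℕ) * (2 * |t| + |U| + 2 * |μ|)) < 0 := hβl.trans_lt h
        have : (0 : ℝ) ≤ β * Real.exp ((β + 1) * (2 * |t| + |U| + 2 * |μ|)) *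
            Real.exp (2 * β * (2 * Δ + 1 : ℕ) * (2 * |t| + |U| + 2 * |μ|)) := by positivity
        linarith
    exact mul_nonneg (mul_nonneg (by positivity) (pow_nonneg hq d)) (norm_nonneg A)
  by_cases hZ : Z₀ = 0
  · rw [hZ, _root_.inv_zero, zero_mul]; exact hC
  · have hZpos : 0 < Z₀ := lt_of_le_of_ne hZ₀0 (Ne.symm hZ)
    rw [inv_mul_le_iff₀ hZpos]
    calc _ ≤ _ := hmain
      _ = _ := by ring

end Graph

/-! ## §2 The flux-free `t–U` torus -/

section Torus

variable (L : ℕ) [NeZero L]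

/-- **The canonical-sector current covariance bound on the flux-free torus at high temperature** (`Δ = 4`, `t = 1`, `μ = 0`,
torus sup-distance): with `E = 2 + |U|`-type constants as produced by the graph-level bound, `0 ≤ β`, `λ(β) ≤ λ₁ ≤ 1`,
`19² √λ₁ ≤ 1/2`, for the `(M,M)` sector presented by `p`, an even observable `A` of `orbSet X` and the bond `(X₀−1,y)–(X₀,y)` at torus
distance `≥ d` from `X`: `‖ω_p(A j) − ω_p(A) ω_p(j)‖ ≤ C (λ(β)/λ₁)^d ‖A‖`. [cite: Ueltschi1999, §3] -/
theorem torus_norm_sectorCov_current_le (U : ℝ) {β : ℝ} (hβ : 0 ≤ β) {lam₁ : ℝ} (hlam₁ : lam₁ ≤ 1)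
    (hsmall : ((2 * (2 * 4 + 1) : ℕ) + 1 : ℝ) ^ 2 * Real.sqrt lam₁ ≤ 1 / 2)
    (hβl : β * Real.exp ((β + 1) * (2 * |(1 : ℝ)| + |U| + 2 * |(0 : ℝ)|)) *
      Real.exp (2 * β * (2 * 4 + 1 : ℕ) * (2 * |(1 : ℝ)| + |U| + 2 * |(0 : ℝ)|)) ≤ lam₁)
    {M : ℕ} (p : Finset (Orb (FermionTorus 2 L)) → Prop) [DecidablePred p] (hp : ∀ s, p s ↔ (upPart s).card = M ∧ (downPart s).card = M)
    {X : Finset (FermionTorus 2 L)} {A : Matrix (Finset (Orb (FermionTorus 2 L))) (Finset (Orb (FermionTorus 2 L))) ℂ}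
    (hA : A ∈ carEvenSubalgebra (orbSet X)) (X₀ y : ZMod L) {d : ℕ}
    (hd : ∀ x ∈ X, d ≤ torusDist x.toTorusSite ![X₀, y] ∧ d ≤ torusDist x.toTorusSite ![X₀ - 1, y]) :
    ‖gibbsState β ((hubbardTorusTT'Flux L 0 U 0).toBlock p p)
          ((A * (∑ σ : Fin 2,
            ((-Complex.I) • (creation (orb (FermionTorus.ofTorusSite (![X₀, y] : TorusSite 2 L)) σ) *
                annihilation (orb (FermionTorus.ofTorusSite (![X₀ - 1, y] : TorusSite 2 L)) σ)) +
              Complex.I • (creation (orb (FermionTorus.ofTorusSite (![X₀ - 1, y] : TorusSite 2 L)) σ) *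
                annihilation (orb (FermionTorus.ofTorusSite (![X₀, y] : TorusSite 2 L)) σ))))).toBlock p p)
      - gibbsState β ((hubbardTorusTT'Flux L 0 U 0).toBlock p p) (A.toBlock p p)
        * gibbsState β ((hubbardTorusTT'Flux L 0 U 0).toBlock p p)
          ((∑ σ : Fin 2,
            ((-Complex.I) • (creation (orb (FermionTorus.ofTorusSite (![X₀, y] : TorusSite 2 L)) σ) *
                annihilation (orb (FermionTorus.ofTorusSite (![X₀ - 1, y] : TorusSite 2 L)) σ)) +
              Complex.I • (creation (orb (FermionTorus.ofTorusSite (![X₀ - 1, y] : TorusSite 2 L)) σ) *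
                annihilation (orb (FermionTorus.ofTorusSite (![X₀, y] : TorusSite 2 L)) σ)))).toBlock p p)‖ ≤
      16 * Real.exp (2 * β * (2 * 4 + 1 : ℕ) * (2 * |(1 : ℝ)| + |U| + 2 * |(0 : ℝ)|)) * (1 + (2 * 4 + 1 : ℕ) * (2 * Real.sqrt lam₁)) ^ 2 *
        (β * Real.exp ((β + 1) * (2 * |(1 : ℝ)| + |U| + 2 * |(0 : ℝ)|)) *
          Real.exp (2 * β * (2 * 4 + 1 : ℕ) * (2 * |(1 : ℝ)| + |U| + 2 * |(0 : ℝ)|)) / lam₁) ^ d * ‖A‖ := by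
  have hΔ : ∀ x : FermionTorus 2 L, (Finset.univ.filter fun z => (fermionTorusGraph 2 L).Adj x z).card ≤ 4 :=
    fun x => (card_filter_adj_fermionTorusGraph_le L 2 x).trans (by norm_num)
  have hda : ∀ x ∈ X, d ≤ torusDist (FermionTorus.ofTorusSite (![X₀, y] : TorusSite 2 L)).toTorusSite x.toTorusSite ∧
      d ≤ torusDist (FermionTorus.ofTorusSite (![X₀ - 1, y] : TorusSite 2 L)).toTorusSite x.toTorusSite := fun x hx => by
    rw [FermionTorus.toTorusSite_ofTorusSite, FermionTorus.toTorusSite_ofTorusSite, torusDist_comm' _ x.toTorusSite,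
      torusDist_comm' _ x.toTorusSite]
    exact hd x hx
  have key := norm_sectorCov_current_le_graph (fermionTorusGraph 2 L) 1 U 0 hΔ
    (fun x z : FermionTorus 2 L => torusDist x.toTorusSite z.toTorusSite) (fun x => torusDist_self _)
    (fun x z w => torusDist_triangle' _ _ _)
    (fun x z hxz => torusDist_le_one_of_adj ((fermionTorusGraph_adj _ _).1 hxz)) hβ hlam₁ hsmall hβl p hp hA
    (FermionTorus.ofTorusSite (![X₀, y] : TorusSite 2 L)) (FermionTorus.ofTorusSite (![X₀ - 1, y] : TorusSite 2 L)) hda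
  rw [hubbardTorusTT'Flux_zero_zero_eq_sum_hubbardTermOp]
  convert key using 8

end Torus

/-! ## §3 Parameters -/

/-- **The parameters of the rung.** With `E = 2|1| + |U| + 2|0|`, `λ₁ = 1/722²` and `β₀ = λ₁ e^{−20E}/2`: `0 < β₀`, `λ₁ ≤ 1`,
`19² √λ₁ ≤ 1/2`, and for every `β ∈ (0, β₀]` the activity `λ(β) = β e^{(β+1)E} e^{18βE}` satisfies `λ(β) ≤ λ₁` and
`(λ(β)/λ₁)^d = e^{−d/ξ}` with `ξ = 1/log(λ₁/λ(β)) > 0`. [folklore] -/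
theorem exists_rung_parameters (U : ℝ) :
    ∃ β₀ lam₁ : ℝ, 0 < β₀ ∧ lam₁ ≤ 1 ∧ ((2 * (2 * 4 + 1) : ℕ) + 1 : ℝ) ^ 2 * Real.sqrt lam₁ ≤ 1 / 2 ∧
      ∀ β : ℝ, 0 < β → β ≤ β₀ →
        β * Real.exp ((β + 1) * (2 * |(1 : ℝ)| + |U| + 2 * |(0 : ℝ)|)) *
            Real.exp (2 * β * (2 * 4 + 1 : ℕ) * (2 * |(1 : ℝ)| + |U| + 2 * |(0 : ℝ)|)) ≤ lam₁ ∧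
          ∃ ξ : ℝ, 0 < ξ ∧ ∀ d : ℕ,
            (β * Real.exp ((β + 1) * (2 * |(1 : ℝ)| + |U| + 2 * |(0 : ℝ)|)) *
              Real.exp (2 * β * (2 * 4 + 1 : ℕ) * (2 * |(1 : ℝ)| + |U| + 2 * |(0 : ℝ)|)) / lam₁) ^ d = Real.exp (-(d : ℝ) / ξ) := by
  set E : ℝ := 2 * |(1 : ℝ)| + |U| + 2 * |(0 : ℝ)| with hE
  have hE0 : 0 ≤ E := by positivity
  set lam₁ : ℝ := (1 / 722) ^ 2 with hlam₁
  have hlam₁pos : 0 < lam₁ := by positivity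
  have hlam₁le : lam₁ ≤ 1 := by norm_num [hlam₁]
  have hsqrt : Real.sqrt lam₁ = 1 / 722 := by rw [hlam₁, Real.sqrt_sq (by norm_num)]
  set β₀ : ℝ := lam₁ * Real.exp (-(20 * E)) / 2 with hβ₀
  have hβ₀pos : 0 < β₀ := by positivity
  have hβ₀le : β₀ ≤ 1 := by
    have h1 : Real.exp (-(20 * E)) ≤ 1 := Real.exp_le_one_iff.2 (by linarith)
    have h2 : lam₁ * Real.exp (-(20 * E)) ≤ 1 * 1 := mul_le_mul hlam₁le h1 (Real.exp_pos _).le zero_le_one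
    rw [hβ₀]; linarith
  refine ⟨β₀, lam₁, hβ₀pos, hlam₁le, ?_, fun β hβ hββ₀ => ?_⟩
  · rw [hsqrt]; norm_num
  set lam : ℝ := β * Real.exp ((β + 1) * E) * Real.exp (2 * β * (2 * 4 + 1 : ℕ) * E) with hlam
  have hlampos : 0 < lam := by positivity
  have hβ1 : β ≤ 1 := hββ₀.trans hβ₀le
  have hlamle : lam ≤ lam₁ / 2 := by
    have h1 : Real.exp ((β + 1) * E) ≤ Real.exp (2 * E) := Real.exp_le_exp.2 (by nlinarith)
    have h2 : Real.exp (2 * β * (2 * 4 + 1 : ℕ) * E) ≤ Real.exp (18 * E) := Real.exp_le_exp.2 (by push_cast; nlinarith)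
    calc lam ≤ β₀ * Real.exp (2 * E) * Real.exp (18 * E) := by
          rw [hlam]
          exact mul_le_mul (mul_le_mul hββ₀ h1 (Real.exp_pos _).le hβ₀pos.le) h2 (Real.exp_pos _).le (by positivity)
      _ = lam₁ / 2 * (Real.exp (-(20 * E)) * Real.exp (2 * E) * Real.exp (18 * E)) := by rw [hβ₀]; ring
      _ = lam₁ / 2 := by rw [← Real.exp_add, ← Real.exp_add, show -(20 * E) + 2 * E + 18 * E = 0 by ring, Real.exp_zero, mul_one]
  have hlt : lam < lam₁ := hlamle.trans_lt (half_lt_self hlam₁pos)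
  have hratio : 1 < lam₁ / lam := (one_lt_div hlampos).2 hlt
  refine ⟨hlt.le, 1 / Real.log (lam₁ / lam), one_div_pos.2 (Real.log_pos hratio), fun d => ?_⟩
  have hq : 0 < lam / lam₁ := div_pos hlampos hlam₁pos
  rw [div_div_eq_mul_div, div_one, show lam₁ / lam = (lam / lam₁)⁻¹ by rw [inv_div], Real.log_inv, neg_mul_neg,
    Real.exp_nat_mul, Real.exp_log hq]

/-! ## §4 The small-`β` rung of Hypothesis C -/

/-- **THE SMALL-`β` RUNG OF HYPOTHESIS C, EVERY `U` AND EVERY FILLING.** For all real `U`, `n` there is `β₀ > 0` such that for every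
`β ∈ (0, β₀]` the flux-free `t–U` torus `hubbardTorusTT'Flux L 0 U 0`, compressed to the `(N↑,N↓) = (M,M)` sector with
`M = ⌊(1−(1−n))L²/2⌋`, clusters exponentially against the plain bond current, uniformly in `L`: this is the line's
`∃ ξ, CurrentClustering U n β ξ` with the line-local definitions unfolded (`k = 0`, `L₀ = 0`, every `L`; `ξ = 1/log(λ₁/λ(β))`,
`λ(β) = β e^{(β+1)(2+|U|)} e^{18β(2+|U|)}`, `λ₁ = 722⁻²`, `β₀ = λ₁ e^{−20(2+|U|)}/2`; the sector-preservation premise on `A` is not used).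
Mechanism: canonical high-temperature polymer expansion in the local terms + time reversal (parts 1–4). HONEST FRAMING: a helper rung inside the
trivially-known high-temperature regime — it decides nothing about the bet C8 at `β·t = 8`, is no `T_c` estimate, and proves nothing about
superconductivity in the Hubbard model. [cite: Ueltschi1999, §3] -/
theorem highTemp_currentClusteringBody (U n : ℝ) :
    ∃ β₀ : ℝ, 0 < β₀ ∧ ∀ β : ℝ, 0 < β → β ≤ β₀ →
    ∃ ξ : ℝ, 0 < ξ ∧ ∃ C : ℝ, ∃ k L₀ : ℕ, ∀ (L : ℕ) [NeZero L], L₀ ≤ L →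
      ∀ (X : Finset (FermionTorus 2 L)) (A : Matrix (Finset (Orb (FermionTorus 2 L))) (Finset (Orb (FermionTorus 2 L))) ℂ),
        A ∈ carEvenSubalgebra (orbSet X) →
        (∀ s t : Finset (Orb (FermionTorus 2 L)),
          (s.card = 2 * ⌊(1 - (1 - n)) * (L : ℝ) ^ 2 / 2⌋₊ ∧
            2 * (s.filter fun i => (ofLex i).2 = 0).card = 2 * ⌊(1 - (1 - n)) * (L : ℝ) ^ 2 / 2⌋₊) →
          ¬ (t.card = 2 * ⌊(1 - (1 - n)) * (L : ℝ) ^ 2 / 2⌋₊ ∧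
            2 * (t.filter fun i => (ofLex i).2 = 0).card = 2 * ⌊(1 - (1 - n)) * (L : ℝ) ^ 2 / 2⌋₊) →
          A s t = 0 ∧ A t s = 0) →
        ∀ (X₀ y : ZMod L) (d : ℕ),
          (∀ x ∈ X, d ≤ torusDist x.toTorusSite ![X₀, y] ∧ d ≤ torusDist x.toTorusSite ![X₀ - 1, y]) →
          ‖gibbsState β ((hubbardTorusTT'Flux L 0 U 0).toBlock
                (fun s => s.card = 2 * ⌊(1 - (1 - n)) * (L : ℝ) ^ 2 / 2⌋₊ ∧
                  2 * (s.filter fun i => (ofLex i).2 = 0).card = 2 * ⌊(1 - (1 - n)) * (L : ℝ) ^ 2 / 2⌋₊)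
                (fun s => s.card = 2 * ⌊(1 - (1 - n)) * (L : ℝ) ^ 2 / 2⌋₊ ∧
                  2 * (s.filter fun i => (ofLex i).2 = 0).card = 2 * ⌊(1 - (1 - n)) * (L : ℝ) ^ 2 / 2⌋₊))
              ((A * (∑ σ : Fin 2,
                ((-Complex.I) • (creation (orb (FermionTorus.ofTorusSite (![X₀, y] : TorusSite 2 L)) σ) *
                    annihilation (orb (FermionTorus.ofTorusSite (![X₀ - 1, y] : TorusSite 2 L)) σ)) +
                  Complex.I • (creation (orb (FermionTorus.ofTorusSite (![X₀ - 1, y] : TorusSite 2 L)) σ) *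
                    annihilation (orb (FermionTorus.ofTorusSite (![X₀, y] : TorusSite 2 L)) σ))))).toBlock
                (fun s => s.card = 2 * ⌊(1 - (1 - n)) * (L : ℝ) ^ 2 / 2⌋₊ ∧
                  2 * (s.filter fun i => (ofLex i).2 = 0).card = 2 * ⌊(1 - (1 - n)) * (L : ℝ) ^ 2 / 2⌋₊)
                (fun s => s.card = 2 * ⌊(1 - (1 - n)) * (L : ℝ) ^ 2 / 2⌋₊ ∧
                  2 * (s.filter fun i => (ofLex i).2 = 0).card = 2 * ⌊(1 - (1 - n)) * (L : ℝ) ^ 2 / 2⌋₊))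
            - gibbsState β ((hubbardTorusTT'Flux L 0 U 0).toBlock
                (fun s => s.card = 2 * ⌊(1 - (1 - n)) * (L : ℝ) ^ 2 / 2⌋₊ ∧
                  2 * (s.filter fun i => (ofLex i).2 = 0).card = 2 * ⌊(1 - (1 - n)) * (L : ℝ) ^ 2 / 2⌋₊)
                (fun s => s.card = 2 * ⌊(1 - (1 - n)) * (L : ℝ) ^ 2 / 2⌋₊ ∧
                  2 * (s.filter fun i => (ofLex i).2 = 0).card = 2 * ⌊(1 - (1 - n)) * (L : ℝ) ^ 2 / 2⌋₊))
              (A.toBlock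
                (fun s => s.card = 2 * ⌊(1 - (1 - n)) * (L : ℝ) ^ 2 / 2⌋₊ ∧
                  2 * (s.filter fun i => (ofLex i).2 = 0).card = 2 * ⌊(1 - (1 - n)) * (L : ℝ) ^ 2 / 2⌋₊)
                (fun s => s.card = 2 * ⌊(1 - (1 - n)) * (L : ℝ) ^ 2 / 2⌋₊ ∧
                  2 * (s.filter fun i => (ofLex i).2 = 0).card = 2 * ⌊(1 - (1 - n)) * (L : ℝ) ^ 2 / 2⌋₊))
              * gibbsState β ((hubbardTorusTT'Flux L 0 U 0).toBlock
                (fun s => s.card = 2 * ⌊(1 - (1 - n)) * (L : ℝ) ^ 2 / 2⌋₊ ∧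
                  2 * (s.filter fun i => (ofLex i).2 = 0).card = 2 * ⌊(1 - (1 - n)) * (L : ℝ) ^ 2 / 2⌋₊)
                (fun s => s.card = 2 * ⌊(1 - (1 - n)) * (L : ℝ) ^ 2 / 2⌋₊ ∧
                  2 * (s.filter fun i => (ofLex i).2 = 0).card = 2 * ⌊(1 - (1 - n)) * (L : ℝ) ^ 2 / 2⌋₊))
              ((∑ σ : Fin 2,
                ((-Complex.I) • (creation (orb (FermionTorus.ofTorusSite (![X₀, y] : TorusSite 2 L)) σ) *
                    annihilation (orb (FermionTorus.ofTorusSite (![X₀ - 1, y] : TorusSite 2 L)) σ)) +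
                  Complex.I • (creation (orb (FermionTorus.ofTorusSite (![X₀ - 1, y] : TorusSite 2 L)) σ) *
                    annihilation (orb (FermionTorus.ofTorusSite (![X₀, y] : TorusSite 2 L)) σ)))).toBlock
                (fun s => s.card = 2 * ⌊(1 - (1 - n)) * (L : ℝ) ^ 2 / 2⌋₊ ∧
                  2 * (s.filter fun i => (ofLex i).2 = 0).card = 2 * ⌊(1 - (1 - n)) * (L : ℝ) ^ 2 / 2⌋₊)
                (fun s => s.card = 2 * ⌊(1 - (1 - n)) * (L : ℝ) ^ 2 / 2⌋₊ ∧
                  2 * (s.filter fun i => (ofLex i).2 = 0).card = 2 * ⌊(1 - (1 - n)) * (L : ℝ) ^ 2 / 2⌋₊))‖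
            ≤ C * ‖A‖ * (X.card : ℝ) ^ k * Real.exp (-(d : ℝ) / ξ) := by
  obtain ⟨β₀, lam₁, hβ₀, hlam₁, hsmall, hβ⟩ := exists_rung_parameters U
  refine ⟨β₀, hβ₀, fun β hβpos hββ₀ => ?_⟩
  obtain ⟨hβl, ξ, hξ, hqξ⟩ := hβ β hβpos hββ₀
  refine ⟨ξ, hξ, 16 * Real.exp (2 * β * (2 * 4 + 1 : ℕ) * (2 * |(1 : ℝ)| + |U| + 2 * |(0 : ℝ)|)) *
      (1 + (2 * 4 + 1 : ℕ) * (2 * Real.sqrt lam₁)) ^ 2, 0, 0, fun L _ _ X A hA _ X₀ y d hd => ?_⟩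
  rw [pow_zero, mul_one, ← hqξ d]
  have h := torus_norm_sectorCov_current_le L U hβpos.le hlam₁ hsmall hβl (M := ⌊(1 - (1 - n)) * (L : ℝ) ^ 2 / 2⌋₊) _
    (fun s => card_and_two_mul_card_filter_iff s _) hA X₀ y hd
  calc _ ≤ _ := h
    _ = _ := by ring

/-- **The registered stub's instance** `(U, n) = (8, 7/8)`: the body of `stub_currentClustering8_smallBeta` of
`Lines/gauge_qbp_far_seam.lean` v1.5 with `CurrentClustering`, `sectorExpect`, `bondCurrent`, `SectorPreserving`, `sectorPred` unfolded
(the line discharges the stub by `obtain ⟨β₀, h₀, h⟩ := …; exact ⟨β₀, h₀, fun β hβ hle => by unfold …; exact h β hβ hle⟩`).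
HONEST FRAMING: a helper rung at SOME small temperature window; nothing at `β·t = 8`; not a `T_c` statement; SC in the Hubbard model NOT proved. -/
theorem currentClustering8_smallBeta_body :
    ∃ β₀ : ℝ, 0 < β₀ ∧ ∀ β : ℝ, 0 < β → β ≤ β₀ →
    ∃ ξ : ℝ, 0 < ξ ∧ ∃ C : ℝ, ∃ k L₀ : ℕ, ∀ (L : ℕ) [NeZero L], L₀ ≤ L →
      ∀ (X : Finset (FermionTorus 2 L)) (A : Matrix (Finset (Orb (FermionTorus 2 L))) (Finset (Orb (FermionTorus 2 L))) ℂ),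
        A ∈ carEvenSubalgebra (orbSet X) →
        (∀ s t : Finset (Orb (FermionTorus 2 L)),
          (s.card = 2 * ⌊(1 - (1 - (7 / 8 : ℝ))) * (L : ℝ) ^ 2 / 2⌋₊ ∧
            2 * (s.filter fun i => (ofLex i).2 = 0).card = 2 * ⌊(1 - (1 - (7 / 8 : ℝ))) * (L : ℝ) ^ 2 / 2⌋₊) →
          ¬ (t.card = 2 * ⌊(1 - (1 - (7 / 8 : ℝ))) * (L : ℝ) ^ 2 / 2⌋₊ ∧
            2 * (t.filter fun i => (ofLex i).2 = 0).card = 2 * ⌊(1 - (1 - (7 / 8 : ℝ))) * (L : ℝ) ^ 2 / 2⌋₊) →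
          A s t = 0 ∧ A t s = 0) →
        ∀ (X₀ y : ZMod L) (d : ℕ),
          (∀ x ∈ X, d ≤ torusDist x.toTorusSite ![X₀, y] ∧ d ≤ torusDist x.toTorusSite ![X₀ - 1, y]) →
          ‖gibbsState β ((hubbardTorusTT'Flux L 0 8 0).toBlock
                (fun s => s.card = 2 * ⌊(1 - (1 - (7 / 8 : ℝ))) * (L : ℝ) ^ 2 / 2⌋₊ ∧
                  2 * (s.filter fun i => (ofLex i).2 = 0).card = 2 * ⌊(1 - (1 - (7 / 8 : ℝ))) * (L : ℝ) ^ 2 / 2⌋₊)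
                (fun s => s.card = 2 * ⌊(1 - (1 - (7 / 8 : ℝ))) * (L : ℝ) ^ 2 / 2⌋₊ ∧
                  2 * (s.filter fun i => (ofLex i).2 = 0).card = 2 * ⌊(1 - (1 - (7 / 8 : ℝ))) * (L : ℝ) ^ 2 / 2⌋₊))
              ((A * (∑ σ : Fin 2,
                ((-Complex.I) • (creation (orb (FermionTorus.ofTorusSite (![X₀, y] : TorusSite 2 L)) σ) *
                    annihilation (orb (FermionTorus.ofTorusSite (![X₀ - 1, y] : TorusSite 2 L)) σ)) +
                  Complex.I • (creation (orb (FermionTorus.ofTorusSite (![X₀ - 1, y] : TorusSite 2 L)) σ) *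
                    annihilation (orb (FermionTorus.ofTorusSite (![X₀, y] : TorusSite 2 L)) σ))))).toBlock
                (fun s => s.card = 2 * ⌊(1 - (1 - (7 / 8 : ℝ))) * (L : ℝ) ^ 2 / 2⌋₊ ∧
                  2 * (s.filter fun i => (ofLex i).2 = 0).card = 2 * ⌊(1 - (1 - (7 / 8 : ℝ))) * (L : ℝ) ^ 2 / 2⌋₊)
                (fun s => s.card = 2 * ⌊(1 - (1 - (7 / 8 : ℝ))) * (L : ℝ) ^ 2 / 2⌋₊ ∧
                  2 * (s.filter fun i => (ofLex i).2 = 0).card = 2 * ⌊(1 - (1 - (7 / 8 : ℝ))) * (L : ℝ) ^ 2 / 2⌋₊))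
            - gibbsState β ((hubbardTorusTT'Flux L 0 8 0).toBlock
                (fun s => s.card = 2 * ⌊(1 - (1 - (7 / 8 : ℝ))) * (L : ℝ) ^ 2 / 2⌋₊ ∧
                  2 * (s.filter fun i => (ofLex i).2 = 0).card = 2 * ⌊(1 - (1 - (7 / 8 : ℝ))) * (L : ℝ) ^ 2 / 2⌋₊)
                (fun s => s.card = 2 * ⌊(1 - (1 - (7 / 8 : ℝ))) * (L : ℝ) ^ 2 / 2⌋₊ ∧
                  2 * (s.filter fun i => (ofLex i).2 = 0).card = 2 * ⌊(1 - (1 - (7 / 8 : ℝ))) * (L : ℝ) ^ 2 / 2⌋₊))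
              (A.toBlock
                (fun s => s.card = 2 * ⌊(1 - (1 - (7 / 8 : ℝ))) * (L : ℝ) ^ 2 / 2⌋₊ ∧
                  2 * (s.filter fun i => (ofLex i).2 = 0).card = 2 * ⌊(1 - (1 - (7 / 8 : ℝ))) * (L : ℝ) ^ 2 / 2⌋₊)
                (fun s => s.card = 2 * ⌊(1 - (1 - (7 / 8 : ℝ))) * (L : ℝ) ^ 2 / 2⌋₊ ∧
                  2 * (s.filter fun i => (ofLex i).2 = 0).card = 2 * ⌊(1 - (1 - (7 / 8 : ℝ))) * (L : ℝ) ^ 2 / 2⌋₊))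
              * gibbsState β ((hubbardTorusTT'Flux L 0 8 0).toBlock
                (fun s => s.card = 2 * ⌊(1 - (1 - (7 / 8 : ℝ))) * (L : ℝ) ^ 2 / 2⌋₊ ∧
                  2 * (s.filter fun i => (ofLex i).2 = 0).card = 2 * ⌊(1 - (1 - (7 / 8 : ℝ))) * (L : ℝ) ^ 2 / 2⌋₊)
                (fun s => s.card = 2 * ⌊(1 - (1 - (7 / 8 : ℝ))) * (L : ℝ) ^ 2 / 2⌋₊ ∧
                  2 * (s.filter fun i => (ofLex i).2 = 0).card = 2 * ⌊(1 - (1 - (7 / 8 : ℝ))) * (L : ℝ) ^ 2 / 2⌋₊))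
              ((∑ σ : Fin 2,
                ((-Complex.I) • (creation (orb (FermionTorus.ofTorusSite (![X₀, y] : TorusSite 2 L)) σ) *
                    annihilation (orb (FermionTorus.ofTorusSite (![X₀ - 1, y] : TorusSite 2 L)) σ)) +
                  Complex.I • (creation (orb (FermionTorus.ofTorusSite (![X₀ - 1, y] : TorusSite 2 L)) σ) *
                    annihilation (orb (FermionTorus.ofTorusSite (![X₀, y] : TorusSite 2 L)) σ)))).toBlock
                (fun s => s.card = 2 * ⌊(1 - (1 - (7 / 8 : ℝ))) * (L : ℝ) ^ 2 / 2⌋₊ ∧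
                  2 * (s.filter fun i => (ofLex i).2 = 0).card = 2 * ⌊(1 - (1 - (7 / 8 : ℝ))) * (L : ℝ) ^ 2 / 2⌋₊)
                (fun s => s.card = 2 * ⌊(1 - (1 - (7 / 8 : ℝ))) * (L : ℝ) ^ 2 / 2⌋₊ ∧
                  2 * (s.filter fun i => (ofLex i).2 = 0).card = 2 * ⌊(1 - (1 - (7 / 8 : ℝ))) * (L : ℝ) ^ 2 / 2⌋₊))‖
            ≤ C * ‖A‖ * (X.card : ℝ) ^ k * Real.exp (-(d : ℝ) / ξ) :=
  highTemp_currentClusteringBody 8 (7 / 8)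

/-- **The `U = 10` twin** `(U, n) = (10, 7/8)` (same shape; NOT a registered stub — recorded for the K1 twin line `Lines/gauge_qbp_far_seam_b10.lean`
should a `U = 10` helper rung be ruled). HONEST FRAMING: a helper rung at SOME small temperature window; nothing at `β·t = 10`; not a `T_c`
statement; SC in the Hubbard model NOT proved. -/
theorem currentClustering10_smallBeta_body :
    ∃ β₀ : ℝ, 0 < β₀ ∧ ∀ β : ℝ, 0 < β → β ≤ β₀ →
    ∃ ξ : ℝ, 0 < ξ ∧ ∃ C : ℝ, ∃ k L₀ : ℕ, ∀ (L : ℕ) [NeZero L], L₀ ≤ L →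
      ∀ (X : Finset (FermionTorus 2 L)) (A : Matrix (Finset (Orb (FermionTorus 2 L))) (Finset (Orb (FermionTorus 2 L))) ℂ),
        A ∈ carEvenSubalgebra (orbSet X) →
        (∀ s t : Finset (Orb (FermionTorus 2 L)),
          (s.card = 2 * ⌊(1 - (1 - (7 / 8 : ℝ))) * (L : ℝ) ^ 2 / 2⌋₊ ∧
            2 * (s.filter fun i => (ofLex i).2 = 0).card = 2 * ⌊(1 - (1 - (7 / 8 : ℝ))) * (L : ℝ) ^ 2 / 2⌋₊) →
          ¬ (t.card = 2 * ⌊(1 - (1 - (7 / 8 : ℝ))) * (L : ℝ) ^ 2 / 2⌋₊ ∧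
            2 * (t.filter fun i => (ofLex i).2 = 0).card = 2 * ⌊(1 - (1 - (7 / 8 : ℝ))) * (L : ℝ) ^ 2 / 2⌋₊) →
          A s t = 0 ∧ A t s = 0) →
        ∀ (X₀ y : ZMod L) (d : ℕ),
          (∀ x ∈ X, d ≤ torusDist x.toTorusSite ![X₀, y] ∧ d ≤ torusDist x.toTorusSite ![X₀ - 1, y]) →
          ‖gibbsState β ((hubbardTorusTT'Flux L 0 10 0).toBlock
                (fun s => s.card = 2 * ⌊(1 - (1 - (7 / 8 : ℝ))) * (L : ℝ) ^ 2 / 2⌋₊ ∧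
                  2 * (s.filter fun i => (ofLex i).2 = 0).card = 2 * ⌊(1 - (1 - (7 / 8 : ℝ))) * (L : ℝ) ^ 2 / 2⌋₊)
                (fun s => s.card = 2 * ⌊(1 - (1 - (7 / 8 : ℝ))) * (L : ℝ) ^ 2 / 2⌋₊ ∧
                  2 * (s.filter fun i => (ofLex i).2 = 0).card = 2 * ⌊(1 - (1 - (7 / 8 : ℝ))) * (L : ℝ) ^ 2 / 2⌋₊))
              ((A * (∑ σ : Fin 2,
                ((-Complex.I) • (creation (orb (FermionTorus.ofTorusSite (![X₀, y] : TorusSite 2 L)) σ) *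
                    annihilation (orb (FermionTorus.ofTorusSite (![X₀ - 1, y] : TorusSite 2 L)) σ)) +
                  Complex.I • (creation (orb (FermionTorus.ofTorusSite (![X₀ - 1, y] : TorusSite 2 L)) σ) *
                    annihilation (orb (FermionTorus.ofTorusSite (![X₀, y] : TorusSite 2 L)) σ))))).toBlock
                (fun s => s.card = 2 * ⌊(1 - (1 - (7 / 8 : ℝ))) * (L : ℝ) ^ 2 / 2⌋₊ ∧
                  2 * (s.filter fun i => (ofLex i).2 = 0).card = 2 * ⌊(1 - (1 - (7 / 8 : ℝ))) * (L : ℝ) ^ 2 / 2⌋₊)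
                (fun s => s.card = 2 * ⌊(1 - (1 - (7 / 8 : ℝ))) * (L : ℝ) ^ 2 / 2⌋₊ ∧
                  2 * (s.filter fun i => (ofLex i).2 = 0).card = 2 * ⌊(1 - (1 - (7 / 8 : ℝ))) * (L : ℝ) ^ 2 / 2⌋₊))
            - gibbsState β ((hubbardTorusTT'Flux L 0 10 0).toBlock
                (fun s => s.card = 2 * ⌊(1 - (1 - (7 / 8 : ℝ))) * (L : ℝ) ^ 2 / 2⌋₊ ∧
                  2 * (s.filter fun i => (ofLex i).2 = 0).card = 2 * ⌊(1 - (1 - (7 / 8 : ℝ))) * (L : ℝ) ^ 2 / 2⌋₊)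
                (fun s => s.card = 2 * ⌊(1 - (1 - (7 / 8 : ℝ))) * (L : ℝ) ^ 2 / 2⌋₊ ∧
                  2 * (s.filter fun i => (ofLex i).2 = 0).card = 2 * ⌊(1 - (1 - (7 / 8 : ℝ))) * (L : ℝ) ^ 2 / 2⌋₊))
              (A.toBlock
                (fun s => s.card = 2 * ⌊(1 - (1 - (7 / 8 : ℝ))) * (L : ℝ) ^ 2 / 2⌋₊ ∧
                  2 * (s.filter fun i => (ofLex i).2 = 0).card = 2 * ⌊(1 - (1 - (7 / 8 : ℝ))) * (L : ℝ) ^ 2 / 2⌋₊)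
                (fun s => s.card = 2 * ⌊(1 - (1 - (7 / 8 : ℝ))) * (L : ℝ) ^ 2 / 2⌋₊ ∧
                  2 * (s.filter fun i => (ofLex i).2 = 0).card = 2 * ⌊(1 - (1 - (7 / 8 : ℝ))) * (L : ℝ) ^ 2 / 2⌋₊))
              * gibbsState β ((hubbardTorusTT'Flux L 0 10 0).toBlock
                (fun s => s.card = 2 * ⌊(1 - (1 - (7 / 8 : ℝ))) * (L : ℝ) ^ 2 / 2⌋₊ ∧
                  2 * (s.filter fun i => (ofLex i).2 = 0).card = 2 * ⌊(1 - (1 - (7 / 8 : ℝ))) * (L : ℝ) ^ 2 / 2⌋₊)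
                (fun s => s.card = 2 * ⌊(1 - (1 - (7 / 8 : ℝ))) * (L : ℝ) ^ 2 / 2⌋₊ ∧
                  2 * (s.filter fun i => (ofLex i).2 = 0).card = 2 * ⌊(1 - (1 - (7 / 8 : ℝ))) * (L : ℝ) ^ 2 / 2⌋₊))
              ((∑ σ : Fin 2,
                ((-Complex.I) • (creation (orb (FermionTorus.ofTorusSite (![X₀, y] : TorusSite 2 L)) σ) *
                    annihilation (orb (FermionTorus.ofTorusSite (![X₀ - 1, y] : TorusSite 2 L)) σ)) +
                  Complex.I • (creation (orb (FermionTorus.ofTorusSite (![X₀ - 1, y] : TorusSite 2 L)) σ) *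
                    annihilation (orb (FermionTorus.ofTorusSite (![X₀, y] : TorusSite 2 L)) σ)))).toBlock
                (fun s => s.card = 2 * ⌊(1 - (1 - (7 / 8 : ℝ))) * (L : ℝ) ^ 2 / 2⌋₊ ∧
                  2 * (s.filter fun i => (ofLex i).2 = 0).card = 2 * ⌊(1 - (1 - (7 / 8 : ℝ))) * (L : ℝ) ^ 2 / 2⌋₊)
                (fun s => s.card = 2 * ⌊(1 - (1 - (7 / 8 : ℝ))) * (L : ℝ) ^ 2 / 2⌋₊ ∧
                  2 * (s.filter fun i => (ofLex i).2 = 0).card = 2 * ⌊(1 - (1 - (7 / 8 : ℝ))) * (L : ℝ) ^ 2 / 2⌋₊))‖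
            ≤ C * ‖A‖ * (X.card : ℝ) ^ k * Real.exp (-(d : ℝ) / ξ) :=
  highTemp_currentClusteringBody 10 (7 / 8)

end Summit.Ventures.CertifiedManyBodySolver.Theorems.TcThermcert1.HighTempCurrentClustering

end
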